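import Literature.Topology.FourManifolds.GaussDiagramParity
import Literature.Topology.FourManifolds.GaussDiagramsRMoves
import HarnessLib

/-!
# Manturov's parity projection for the anti-parallel second Reidemeister move

Supplement to `GaussDiagramParity.lean` (Gaussian parity, deletion of odd chords `eraseOdd`,
Manturov's projection theorem for the move set `GaussDiagram.PolyakMove`) for the enlarged move set
`GaussDiagram.RMove` of `GaussDiagramsRMoves.lean`, whose extra constructor `omega2c` is the
anti-parallel second move `Ω2c/Ω2d` of Polyak (2010): two new chords with adjacent over-passages
(`x` first) and adjacent under-passages in the opposite order (`y` first).

* `isEvenChord_omega2c` — Manturov's parity axioms for this move: no old chord changes its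
  parity and the two new chords have the same parity (Manturov (2012), §3); hence the even chords
  of the target (`evenChords_omega2c_of_even`, `evenChords_omega2c_of_odd`);
* `eraseOdd_omega2c` — **deleting the odd chords commutes with the move**: both new chords are
  deleted (and the image is `G.eraseOdd`) or both are kept (and the image is the same move `Ω2c`
  on `G.eraseOdd`, `rMove_eraseOdd_omega2c_of_even`);
* `eraseOdd_rMove`, `parityProj_rMove` — one move of `RMove`, one deletion;
* **Manturov's projection theorem for `RMove`** (`eqvGen_rMove_allEven_of_rEquiv`): two all-even
  Gauss diagrams related by `GaussDiagram.REquiv` (through arbitrary, possibly non-realisable,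
  diagrams) are related by a chain of moves of `RMove` through all-even diagrams. The target
  relation is written out with `Relation.EqvGen` (no new definition; for `PolyakMove` it is
  `EvenEquiv`).

Everything is proved; no definition and no named fact is introduced.

## References

* V. O. Manturov, *Free knots and parity*, Ser. Knots Everything 46 (2012) 321–345
  (arXiv:0912.5348), §3, §3.1 Thm. 1, §3.2 Thm. 2. [cite: Manturov2011, §3]
* M. Polyak, *Minimal generating sets of Reidemeister moves*, Quantum Topol. 1 (2010) 399–411,
  Thm. 1.2, Fig. 2 (`Ω2c, Ω2d`). [cite: Polyak2010, Thm 1.2]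
-/

open Function Set

noncomputable section

namespace Literature.Topology.FourManifolds

namespace GaussDiagram

variable (G : GaussDiagram)

/-! ## Parity and the anti-parallel second Reidemeister move -/

section AntiBigon

variable (o : Fin (2 * G.n + 2)) (u : Fin (2 * G.n + 1)) (ε : ℤˣ)
  (o' : Fin (2 * (G.n + 1) + 2)) (u' : Fin (2 * (G.n + 1) + 1))
  (hover : (((G.insertChord o u ε).insertChord o' u' (-ε)).overPos (Fin.last (G.n + 1)) : ℕ) =
    ((G.insertChord o u ε).insertChord o' u' (-ε)).overPos (Fin.last G.n).castSucc + 1)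
  (hunder : (((G.insertChord o u ε).insertChord o' u' (-ε)).underPos (Fin.last G.n).castSucc : ℕ) =
    ((G.insertChord o u ε).insertChord o' u' (-ε)).underPos (Fin.last (G.n + 1)) + 1)

/-- The under-passage of the first new chord is just above that of the second (value form of the
hypothesis `hunder` of `RMove.omega2c`). [folklore] -/
theorem val_fst_under_of_omega2c
    (hunder : (((G.insertChord o u ε).insertChord o' u' (-ε)).underPos (Fin.last G.n).castSucc : ℕ) =
      ((G.insertChord o u ε).insertChord o' u' (-ε)).underPos (Fin.last (G.n + 1)) + 1) :
    ((G.insertChord o u ε).insEmb o' u' (o.succAbove u) : ℕ) = (o'.succAbove u' : ℕ) + 1 := by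
  rw [val_underPos_insertChord_insertChord_last, val_underPos_insertChord_insertChord_castSucc_last] at hunder
  exact hunder

include hover hunder in
/-- **Manturov's parity axioms for the anti-parallel second move**: no old chord changes its
parity (every old point is shifted by an even amount by the two adjacent pairs of new points), and
the two new chords have the same parity. Manturov (2012), §3 (second move: "the parity of the
remaining vertices does not change"; "the second Reidemeister move adds two vertices of the same
parity"). [cite: Manturov2011, §3] -/
theorem isEvenChord_omega2c :
    (∀ j : Fin G.n, ((G.insertChord o u ε).insertChord o' u' (-ε)).IsEvenChord j.castSucc.castSucc ↔
        G.IsEvenChord j) ∧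
      (((G.insertChord o u ε).insertChord o' u' (-ε)).IsEvenChord (Fin.last G.n).castSucc ↔
        ((G.insertChord o u ε).insertChord o' u' (-ε)).IsEvenChord (Fin.last (G.n + 1))) := by
  refine ⟨fun j ↦ ?_, ?_⟩
  · -- every old point keeps its parity
    have hmod : ∀ q : Fin (2 * G.n),
        ((G.insertChord o u ε).insEmb o' u' (G.insEmb o u q) : ℕ) % 2 = q % 2 := by
      intro q
      have ha : (o' : ℕ) = ((G.insertChord o u ε).insEmb o' u' o : ℕ) + 1 :=
        G.val_snd_over_of_omega2a o u ε o' u' hover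
      have hb : ((G.insertChord o u ε).insEmb o' u' (o.succAbove u) : ℕ) = (o'.succAbove u' : ℕ) + 1 :=
        G.val_fst_under_of_omega2c o u ε o' u' hunder
      have h2 : ((G.insertChord o u ε).insEmb o' u' (G.insEmb o u q) : ℕ) =
          (G.insEmb o u q : ℕ) +
            (if (o' : ℕ) < (G.insertChord o u ε).insEmb o' u' (G.insEmb o u q) then 1 else 0) +
            (if (o'.succAbove u' : ℕ) < (G.insertChord o u ε).insEmb o' u' (G.insEmb o u q) then 1 else 0) :=
        (G.insertChord o u ε).val_insEmb_eq_add o' u' (G.insEmb o u q)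
      have h1 : (G.insEmb o u q : ℕ) = q + (if (o : ℕ) < G.insEmb o u q then 1 else 0) +
          (if (o.succAbove u : ℕ) < G.insEmb o u q then 1 else 0) :=
        G.val_insEmb_eq_add o u q
      have hlt1 : ((G.insertChord o u ε).insEmb o' u' o : ℕ) < (G.insertChord o u ε).insEmb o' u' (G.insEmb o u q) ↔
          (o : ℕ) < G.insEmb o u q :=
        (G.insertChord o u ε).val_insEmb_lt_val_insEmb_iff o' u' o (G.insEmb o u q)
      have hlt2 : ((G.insertChord o u ε).insEmb o' u' (o.succAbove u) : ℕ) <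
          (G.insertChord o u ε).insEmb o' u' (G.insEmb o u q) ↔ (o.succAbove u : ℕ) < G.insEmb o u q :=
        (G.insertChord o u ε).val_insEmb_lt_val_insEmb_iff o' u' (o.succAbove u) (G.insEmb o u q)
      have hne1 : ((G.insertChord o u ε).insEmb o' u' (G.insEmb o u q) : ℕ) ≠ o' := fun h ↦
        (G.insertChord o u ε).insEmb_ne_fst o' u' _ (Fin.ext h)
      have hne2 : ((G.insertChord o u ε).insEmb o' u' (G.insEmb o u q) : ℕ) ≠ o'.succAbove u' := fun h ↦
        (G.insertChord o u ε).insEmb_ne_snd o' u' _ (Fin.ext h)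
      -- the old point is not the under-passage of the first new chord, before and after the insertion
      have hne3 : (G.insEmb o u q : ℕ) ≠ o.succAbove u := fun h ↦ G.insEmb_ne_snd o u q (Fin.ext h)
      have hlt3 : ((G.insertChord o u ε).insEmb o' u' (G.insEmb o u q) : ℕ) <
          (G.insertChord o u ε).insEmb o' u' (o.succAbove u) ↔ (G.insEmb o u q : ℕ) < o.succAbove u :=
        (G.insertChord o u ε).val_insEmb_lt_val_insEmb_iff o' u' (G.insEmb o u q) (o.succAbove u)
      by_cases c1 : (o : ℕ) < G.insEmb o u q <;>
        by_cases c2 : (o.succAbove u : ℕ) < G.insEmb o u q <;>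
          by_cases c3 : (o' : ℕ) < (G.insertChord o u ε).insEmb o' u' (G.insEmb o u q) <;>
            by_cases c4 : (o'.succAbove u' : ℕ) < (G.insertChord o u ε).insEmb o' u' (G.insEmb o u q) <;>
              simp only [c1, c2, c3, c4, ↓reduceIte] at h1 h2 <;> omega
    rw [isEvenChord_iff, isEvenChord_iff, val_overPos_insertChord_insertChord_castSucc_castSucc,
      val_underPos_insertChord_insertChord_castSucc_castSucc]
    have h1 := hmod (G.overPos j)
    have h2 := hmod (G.underPos j)
    omega
  · rw [isEvenChord_iff, isEvenChord_iff, hover, hunder]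
    constructor <;> intro h <;> omega

include hover hunder in
/-- **The even chords after an even anti-parallel second move** are the old even chords and the
two new chords. [folklore] -/
theorem evenChords_omega2c_of_even
    (hy : ((G.insertChord o u ε).insertChord o' u' (-ε)).IsEvenChord (Fin.last (G.n + 1))) :
    ((G.insertChord o u ε).insertChord o' u' (-ε)).evenChords =
      (G.insertChord o u ε).keepSet (G.keepSet G.evenChords) := by
  obtain ⟨hold, hxy⟩ := G.isEvenChord_omega2c o u ε o' u' hover hunder
  have key : ∀ j'' : Fin (G.n + 2), ((G.insertChord o u ε).insertChord o' u' (-ε)).IsEvenChord j'' ↔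
      j'' ∈ (G.insertChord o u ε).keepSet (G.keepSet G.evenChords) := by
    intro j''
    refine Iff.trans ?_ ((G.insertChord o u ε).mem_keepSet_iff (G.keepSet G.evenChords) j'').symm
    rcases Fin.eq_castSucc_or_eq_last j'' with ⟨j', rfl⟩ | rfl
    · rcases Fin.eq_castSucc_or_eq_last j' with ⟨j, rfl⟩ | rfl
      · rw [hold j]
        constructor
        · exact fun h ↦ Or.inr ⟨j.castSucc, (G.mem_keepSet_iff _ _).2 (Or.inr ⟨j, (G.mem_evenChords j).2 h, rfl⟩), rfl⟩
        · rintro (h | ⟨j₁, hj₁, h⟩)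
          · exact absurd h (Fin.castSucc_lt_last _).ne
          · obtain rfl : j₁ = j.castSucc := Fin.castSucc_injective _ h
            rcases (G.mem_keepSet_iff _ _).1 hj₁ with h' | ⟨i, hi, h'⟩
            · exact absurd h' (Fin.castSucc_lt_last _).ne
            · rw [← Fin.castSucc_injective _ h']; exact (G.mem_evenChords i).1 hi
      · rw [hxy]
        simp only [hy, true_iff]
        exact Or.inr ⟨Fin.last G.n, (G.mem_keepSet_iff _ _).2 (Or.inl rfl), rfl⟩
    · simp only [hy, true_iff]
      exact Or.inl rfl
  exact Finset.ext fun j'' ↦ by rw [mem_evenChords]; exact key j''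

include hover hunder in
/-- **The even chords after an odd anti-parallel second move** are the old even chords. [folklore] -/
theorem evenChords_omega2c_of_odd
    (hy : ¬ ((G.insertChord o u ε).insertChord o' u' (-ε)).IsEvenChord (Fin.last (G.n + 1))) :
    ((G.insertChord o u ε).insertChord o' u' (-ε)).evenChords =
      (G.insertChord o u ε).castSet (G.castSet G.evenChords) := by
  obtain ⟨hold, hxy⟩ := G.isEvenChord_omega2c o u ε o' u' hover hunder
  have key : ∀ j'' : Fin (G.n + 2), ((G.insertChord o u ε).insertChord o' u' (-ε)).IsEvenChord j'' ↔
      j'' ∈ (G.insertChord o u ε).castSet (G.castSet G.evenChords) := by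
    intro j''
    refine Iff.trans ?_ ((G.insertChord o u ε).mem_castSet_iff (G.castSet G.evenChords) j'').symm
    rcases Fin.eq_castSucc_or_eq_last j'' with ⟨j', rfl⟩ | rfl
    · rcases Fin.eq_castSucc_or_eq_last j' with ⟨j, rfl⟩ | rfl
      · rw [hold j]
        constructor
        · exact fun h ↦ ⟨j.castSucc, (G.mem_castSet_iff _ _).2 ⟨j, (G.mem_evenChords j).2 h, rfl⟩, rfl⟩
        · rintro ⟨j₁, hj₁, h⟩
          obtain rfl : j₁ = j.castSucc := Fin.castSucc_injective _ h
          obtain ⟨i, hi, h'⟩ := (G.mem_castSet_iff _ _).1 hj₁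
          rw [← Fin.castSucc_injective _ h']; exact (G.mem_evenChords i).1 hi
      · rw [hxy]
        simp only [hy, false_iff]
        rintro ⟨j₁, hj₁, h⟩
        obtain rfl : j₁ = Fin.last G.n := Fin.castSucc_injective _ h
        exact G.last_notMem_castSet _ hj₁
    · simp only [hy, false_iff]
      rintro ⟨j₁, -, h⟩
      exact (Fin.castSucc_lt_last _).ne h
  exact Finset.ext fun j'' ↦ by rw [mem_evenChords]; exact key j''

include hover hunder in
/-- **Deleting the odd chords of an even anti-parallel bigon gives the same move `Ω2c` on
`G.eraseOdd`** (at the ranks of the new points, with the same signs). Manturov (2012), §3,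
§3.1 Thm. 1 (second move, even case). [cite: Manturov2011, §3.1 Thm. 1] -/
theorem rMove_eraseOdd_omega2c_of_even
    (hy : ((G.insertChord o u ε).insertChord o' u' (-ε)).IsEvenChord (Fin.last (G.n + 1))) :
    RMove G.eraseOdd ((G.insertChord o u ε).insertChord o' u' (-ε)).eraseOdd := by
  have hx : ((G.insertChord o u ε).insertChord o' u' (-ε)).IsEvenChord (Fin.last G.n).castSucc :=
    (G.isEvenChord_omega2c o u ε o' u' hover hunder).2.2 hy
  have hS : ((G.insertChord o u ε).insertChord o' u' (-ε)).evenChords =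
      (G.insertChord o u ε).keepSet (G.keepSet G.evenChords) :=
    G.evenChords_omega2c_of_even o u ε o' u' hover hunder hy
  -- the two insertions at the ranks
  have hT' : (G.insertChord o u ε).subdiagram (G.keepSet G.evenChords) =
      G.eraseOdd.insertChord (G.insO o u G.evenChords) (G.insU o u G.evenChords) ε :=
    G.subdiagram_insertChord_keep o u ε G.evenChords
  have hH : ((G.insertChord o u ε).insertChord o' u' (-ε)).eraseOdd =
      (G.eraseOdd.insertChord (G.insO o u G.evenChords) (G.insU o u G.evenChords) ε).insertChord
        (((G.insertChord o u ε).insO o' u' (G.keepSet G.evenChords)).cast (by rw [hT']))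
        (((G.insertChord o u ε).insU o' u' (G.keepSet G.evenChords)).cast (by rw [hT'])) (-ε) := by
    unfold eraseOdd
    exact ((congrArg ((G.insertChord o u ε).insertChord o' u' (-ε)).subdiagram hS).trans
      ((G.insertChord o u ε).subdiagram_insertChord_keep o' u' (-ε) (G.keepSet G.evenChords))).trans
      (insertChord_congr hT' _ _ _)
  rw [hH]
  -- the indices of the two new chords in the image, read on `G''.eraseOdd`
  have hc1 : (G.keepSet G.evenChords).card = G.evenChords.card + 1 := G.card_keepSet G.evenChords
  have hc1' : @Finset.card (Fin (G.insertChord o u ε).n) (G.keepSet G.evenChords) = G.evenChords.card + 1 :=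
    G.card_keepSet G.evenChords
  have hc2 : ((G.insertChord o u ε).keepSet (G.keepSet G.evenChords)).card = (G.keepSet G.evenChords).card + 1 :=
    (G.insertChord o u ε).card_keepSet (G.keepSet G.evenChords)
  have hc2' : @Finset.card (Fin ((G.insertChord o u ε).insertChord o' u' (-ε)).n)
      ((G.insertChord o u ε).keepSet (G.keepSet G.evenChords)) = (G.keepSet G.evenChords).card + 1 :=
    (G.insertChord o u ε).card_keepSet (G.keepSet G.evenChords)
  have hcard : ((G.insertChord o u ε).insertChord o' u' (-ε)).evenChords.card = G.evenChords.card + 2 := by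
    rw [hS]; omega
  let ix : Fin ((G.insertChord o u ε).insertChord o' u' (-ε)).eraseOdd.n :=
    ⟨G.evenChords.card, by show _ < ((G.insertChord o u ε).insertChord o' u' (-ε)).evenChords.card; omega⟩
  let iy : Fin ((G.insertChord o u ε).insertChord o' u' (-ε)).eraseOdd.n :=
    ⟨G.evenChords.card + 1, by show _ < ((G.insertChord o u ε).insertChord o' u' (-ε)).evenChords.card; omega⟩
  have hsx : ((G.insertChord o u ε).insertChord o' u' (-ε)).subChord
      ((G.insertChord o u ε).insertChord o' u' (-ε)).evenChords ix = (Fin.last G.n).castSucc := by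
    rw [subChord_congr _ hS (i₂ := ⟨G.evenChords.card, by omega⟩) rfl,
      (G.insertChord o u ε).subChord_keepSet_castSucc o' u' (-ε) (G.keepSet G.evenChords) _
        ⟨G.evenChords.card, by omega⟩ rfl]
    exact congrArg Fin.castSucc (G.subChord_keepSet_last o u ε G.evenChords ⟨G.evenChords.card, by omega⟩ rfl)
  have hsy : ((G.insertChord o u ε).insertChord o' u' (-ε)).subChord
      ((G.insertChord o u ε).insertChord o' u' (-ε)).evenChords iy = Fin.last (G.n + 1) := by
    rw [subChord_congr _ hS (i₂ := ⟨G.evenChords.card + 1, by omega⟩) rfl]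
    exact (G.insertChord o u ε).subChord_keepSet_last o' u' (-ε) (G.keepSet G.evenChords) _ (by simpa using hc1.symm)
  have hxmem : (Fin.last G.n).castSucc ∈ ((G.insertChord o u ε).insertChord o' u' (-ε)).evenChords :=
    (mem_evenChords _ _).2 hx
  have hymem : Fin.last (G.n + 1) ∈ ((G.insertChord o u ε).insertChord o' u' (-ε)).evenChords :=
    (mem_evenChords _ _).2 hy
  have hO : (((G.insertChord o u ε).insertChord o' u' (-ε)).eraseOdd.overPos iy : ℕ) =
      ((G.insertChord o u ε).insertChord o' u' (-ε)).eraseOdd.overPos ix + 1 := by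
    show ((((G.insertChord o u ε).insertChord o' u' (-ε)).subdiagram _).overPos iy : ℕ) =
      (((G.insertChord o u ε).insertChord o' u' (-ε)).subdiagram _).overPos ix + 1
    rw [val_overPos_subdiagram, val_overPos_subdiagram, hsx, hsy, hover]
    exact subRank_succ_of_mem _ _ (overPos_mem_subEnds _ _ hxmem)
  have hU : (((G.insertChord o u ε).insertChord o' u' (-ε)).eraseOdd.underPos ix : ℕ) =
      ((G.insertChord o u ε).insertChord o' u' (-ε)).eraseOdd.underPos iy + 1 := by
    show ((((G.insertChord o u ε).insertChord o' u' (-ε)).subdiagram _).underPos ix : ℕ) =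
      (((G.insertChord o u ε).insertChord o' u' (-ε)).subdiagram _).underPos iy + 1
    rw [val_underPos_subdiagram, val_underPos_subdiagram, hsx, hsy, hunder]
    exact subRank_succ_of_mem _ _ (underPos_mem_subEnds _ _ hymem)
  refine RMove.omega2c G.eraseOdd (G.insO o u G.evenChords) (G.insU o u G.evenChords) _ _ ε ?_ ?_
  · rw [← val_overPos_congr hH (i₁ := iy) rfl, ← val_overPos_congr hH (i₁ := ix) rfl]
    exact hO
  · rw [← val_underPos_congr hH (i₁ := ix) rfl, ← val_underPos_congr hH (i₁ := iy) rfl]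
    exact hU

include hover hunder in
/-- **Deleting the odd chords commutes with the anti-parallel second Reidemeister move**: the two
new chords have the same parity, so they are deleted together (and the image is `G.eraseOdd`) or
kept together (and the image is the same move `Ω2c` on `G.eraseOdd`). Manturov (2012), §3, §3.1,
Thm. 1. [cite: Manturov2011, §3.1 Thm. 1] -/
theorem eraseOdd_omega2c :
    ((G.insertChord o u ε).insertChord o' u' (-ε)).eraseOdd = G.eraseOdd ∨
      RMove G.eraseOdd ((G.insertChord o u ε).insertChord o' u' (-ε)).eraseOdd := by
  by_cases hy : ((G.insertChord o u ε).insertChord o' u' (-ε)).IsEvenChord (Fin.last (G.n + 1))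
  · exact Or.inr (G.rMove_eraseOdd_omega2c_of_even o u ε o' u' hover hunder hy)
  · -- both new chords are odd: they are deleted, and the image is `G.eraseOdd`
    refine Or.inl ?_
    unfold eraseOdd
    exact ((congrArg ((G.insertChord o u ε).insertChord o' u' (-ε)).subdiagram
      (G.evenChords_omega2c_of_odd o u ε o' u' hover hunder hy)).trans
      ((G.insertChord o u ε).subdiagram_insertChord_drop o' u' (-ε) _)).trans
      (G.subdiagram_insertChord_drop o u ε _)

end AntiBigon

/-! ## The parity projection of an `REquiv`-equivalence -/

section Projection

/-- **One move of `RMove`, one deletion.** Manturov (2012), §3.1, Thm. 1 (proof).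
[cite: Manturov2011, §3.1 Thm. 1] -/
theorem eraseOdd_rMove {G H : GaussDiagram} (h : RMove G H) :
    G.eraseOdd = H.eraseOdd ∨ RMove G.eraseOdd H.eraseOdd := by
  cases h with
  | polyak h => exact (eraseOdd_polyakMove h).imp id RMove.polyak
  | omega2c o u o' u' ε hover hunder => exact (G.eraseOdd_omega2c o u ε o' u' hover hunder).imp Eq.symm id

/-- **Iterated deletion of one move of `RMove`.** [cite: Manturov2011, §3.1 Thm. 1] -/
theorem parityProj_rMove : ∀ (m : ℕ) {G H : GaussDiagram}, RMove G H →
    parityProj m G = parityProj m H ∨ RMove (parityProj m G) (parityProj m H)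
  | 0, _, _, h => Or.inr h
  | m + 1, G, H, h => by
    show parityProj m G.eraseOdd = parityProj m H.eraseOdd ∨
      RMove (parityProj m G.eraseOdd) (parityProj m H.eraseOdd)
    rcases eraseOdd_rMove h with h' | h'
    · exact Or.inl (by rw [h'])
    · exact parityProj_rMove m h'

/-- **The iterated deletions of `REquiv`-equivalent diagrams are related by moves of `RMove`
through all-even diagrams**, for all large fuels. Manturov (2012), §3.2, Thm. 2 (proof).
[cite: Manturov2011, §3.2 Thm. 2] -/
theorem exists_eqvGen_parityProj_of_rEquiv {G G' : GaussDiagram} (h : G.REquiv G') :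
    ∃ M : ℕ, ∀ m, M ≤ m →
      Relation.EqvGen (fun A B ↦ RMove A B ∧ A.AllEven ∧ B.AllEven) (parityProj m G) (parityProj m G') := by
  have h' : Relation.EqvGen RMove G G' := h
  clear h
  induction h' with
  | rel G H hGH =>
    refine ⟨max G.n H.n, fun m hm ↦ ?_⟩
    rcases parityProj_rMove m hGH with h | h
    · rw [h]; exact Relation.EqvGen.refl _
    · exact Relation.EqvGen.rel _ _ ⟨h, allEven_parityProj m (Or.inr (le_of_max_le_left hm)),
        allEven_parityProj m (Or.inr (le_of_max_le_right hm))⟩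
  | refl G => exact ⟨0, fun m _ ↦ Relation.EqvGen.refl _⟩
  | symm G H _ ih =>
    obtain ⟨M, hM⟩ := ih
    exact ⟨M, fun m hm ↦ Relation.EqvGen.symm _ _ (hM m hm)⟩
  | trans G H K _ _ ih₁ ih₂ =>
    obtain ⟨M₁, h₁⟩ := ih₁
    obtain ⟨M₂, h₂⟩ := ih₂
    exact ⟨max M₁ M₂, fun m hm ↦
      Relation.EqvGen.trans _ _ _ (h₁ m (le_of_max_le_left hm)) (h₂ m (le_of_max_le_right hm))⟩

/-- **The parity projections of `REquiv`-equivalent Gauss diagrams are related by moves of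
`RMove` through all-even diagrams.** Manturov (2012), §3.2, Thm. 2 and Thm. 3.
[cite: Manturov2011, §3.2 Thm. 2] -/
theorem eqvGen_rMove_allEven_parityProjection {G G' : GaussDiagram} (h : G.REquiv G') :
    Relation.EqvGen (fun A B ↦ RMove A B ∧ A.AllEven ∧ B.AllEven) G.parityProjection G'.parityProjection := by
  obtain ⟨M, hM⟩ := exists_eqvGen_parityProj_of_rEquiv h
  have := hM (max M (max G.n G'.n)) (le_max_left _ _)
  rwa [G.parityProj_of_le (le_trans (le_max_left _ _) (le_max_right _ _)),
    G'.parityProj_of_le (le_trans (le_max_right _ _) (le_max_right _ _))] at this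

/-- **Manturov's projection theorem for the move set `RMove`** (`k = 1`): two Gauss diagrams all
of whose chords are even which are `REquiv`-equivalent (through arbitrary, possibly
non-realisable, Gauss diagrams) are related by a chain of moves of `RMove` through Gauss diagrams
all of whose chords are even. Manturov (2012), §3.2, Thm. 2. [cite: Manturov2011, §3.2 Thm. 2] -/
theorem eqvGen_rMove_allEven_of_rEquiv {G G' : GaussDiagram} (hG : G.AllEven) (hG' : G'.AllEven)
    (h : G.REquiv G') :
    Relation.EqvGen (fun A B ↦ RMove A B ∧ A.AllEven ∧ B.AllEven) G G' := by
  have := eqvGen_rMove_allEven_parityProjection h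
  rwa [G.parityProjection_eq_self hG, G'.parityProjection_eq_self hG'] at this

/-- Conversely a chain of moves of `RMove` through all-even diagrams is an `REquiv`-equivalence.
[folklore] -/
theorem rEquiv_of_eqvGen_rMove_allEven {G G' : GaussDiagram}
    (h : Relation.EqvGen (fun A B ↦ RMove A B ∧ A.AllEven ∧ B.AllEven) G G') : G.REquiv G' := by
  induction h with
  | rel _ _ h => exact h.1.rEquiv
  | refl _ => exact REquiv.refl _
  | symm _ _ _ ih => exact ih.symm
  | trans _ _ _ _ _ ih₁ ih₂ => exact ih₁.trans ih₂

end Projection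

end GaussDiagram

end Literature.Topology.FourManifolds
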